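import Summits.BirchSwinnertonDyer.BirchSwinnertonDyer.Theorems.BiquadraticEisensteinDescentHeegnerTwistCouplingInSupplySylvesterTwistShaThree
import Literature.NumberTheory.EllipticCurves.MordellCurveThreeDescentImage
import Literature.NumberTheory.EllipticCurves.MordellCurveThreeDescentKernel
import HarnessLib

set_option linter.dupNamespace false -- `Summit.BirchSwinnertonDyer.BirchSwinnertonDyer.Theorems.…` (summit = sub, D-0017)
set_option autoImplicit false

/-!
# Crux `HeegnerTwistCouplingInSupply` (stmt-BirchSwinnertonDyer-21381) — programme «TWISTED 3-ISOGENY DESCENT», file P7c-C1: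
# point descent through a twisted `3`-isogeny — `E'(ℚ) ⊆ φ(E(ℚ))` from a SELMER-form box over the Kummer field

Route `BiquadraticEisensteinDescent` (cell `pub/bsd-wall`, width seat `bsd-wall-cm-bed-w4` g33; `--supports` 21381, helper). The RANK
half of the descent, generic in the Kummer field. Data: a quadratic number field `L = ℚ(g)`, `g² = d ∈ ℚ`, with non-trivial automorphism
`c` (`c g = −g`) and a lift `c̄` of `c` to `L̄` negating `√−3`; a kernel-`x` three-pair `φ : E = y² = x³ + k → E' = y² = x³ − 27k` over `ℚ`
(`IsKernelXThreePair 0 0 k`); the Mordell `μ₃`-datum constant `c₁ ∈ L` with `k = −3c₁²`, `c c₁ = −c₁` (so the partner `Y² = X³ + 81c₁²`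
is `E'_L`); and the box in Selmer form «every norm-cube `u ∈ L^×` whose class `[C_u]` is in `Ш(E_L/L)` is a cube» (files P7c-B1/B2).

* §1 `pointFun_eq_of_mul_eq_of_sq_eq` (Vélu's map depends on `ms` and `s²` only), `isVeluThreePair_baseChange_mordell` (the pair
  `(E_ℚ̄, E'_ℚ̄)` with parameters `(0, s)`, `s² = k`), `exists_ringHom_iotaE_comp` (an embedding `j : L → ℚ̄` with `ι ∘ j = (L → L̄)`),
  `galAut_apply_ringHom_dichotomy` (every `σ ∈ Γ_ℚ` acts on `j(L)` as `1` or as `c`), `galAut_sigmaTilde_ringHom` (`σ̃` acts as `c`);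
* §2 ★★ `exists_fixed_preimage_of_fixed` — **every `Γ_ℚ`-fixed point `P'` of `E'(ℚ̄)` is `φ(Q)` for a `Γ_ℚ`-fixed `Q ∈ E(ℚ̄)`**:
  `P' = (X₀, Y₀)` with `X₀, Y₀ ∈ ℚ`, `X₀ ≠ 0` (as `k'` is not a rational square); `u = δ(P') = Y₀ + 9c₁ ∈ L` is a norm-cube
  (`u·c(u) = Y₀² − 81c₁² = X₀³`) with trivial torsor class (`torsorClass_phiDescent`), hence a cube `w³` (the box); the explicit
  `φ`-preimage `Q = (6c₁/(w − X₀/w), …)` (tree `preimX`, `preimY`, `pointFun_preim`) has coordinates in `j(L)`; `σ ∈ Γ_ℚ` acting as `1`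
  on `j(L)` fixes `Q`, and `σ` acting as `c` moves `Q` like `σ̃` does; finally `σ̃Q − Q ∈ ker φ = {O, ±T}` with `σ̃T = T` and `σ̃²` trivial
  on `j(L)` forces `σ̃Q = Q` (`σ̃²Q = Q + 2(σ̃Q − Q)` and `2T ≠ O`).

HONEST FRAMING: the point-level (Selmer) half of a `3`-isogeny descent, generic; the instances (φ- and φ̂-side of `y² = x³ − 2p²`), the
rank, the crux (residual C⁺) and BSD are untouched. THEOREMS ONLY (no `def`, no named fact, no sorry). Supports stmt-BirchSwinnertonDyer-21381.
[cite: CohenPazuki2009, Proposition 2.2, Theorem 2.1] [cite: SilvermanAEC2009, Thm. X.4.2 (a), Prop. X.4.9, Remark X.4.7]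
-/

noncomputable section

open scoped Classical

namespace Summit.BirchSwinnertonDyer.BirchSwinnertonDyer.Theorems.SylvesterTwistDescent

open Literature.NumberTheory.EllipticCurves Literature.NumberTheory.EllipticCurves.MordellDescent
open Literature.NumberTheory.EllipticCurves.TwistedKummer Literature.NumberTheory.QuadraticFields
open Literature.NumberTheory.GaloisRepresentations NumberField
open WeierstrassCurve

/-! ## §1 Small inputs -/

section Inputs

/-- **Vélu's map depends on `ms` and `s²` only**: two Vélu pairs `(m₁, s₁)`, `(m₂, s₂)` on the same curves with `m₁s₁ = m₂s₂`,
`s₁² = s₂²` have the same map on points (`X = (x³ + 4msx + 4s²)/x²`, `Y = y(x³ − 4msx − 8s²)/x³`). [cite: SilvermanAEC2009, Remark III.4.13.2] -/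
theorem pointFun_eq_of_mul_eq_of_sq_eq {F' : Type*} [Field F'] {W W' : WeierstrassCurve F'} {m₁ s₁ m₂ s₂ : F'}
    (hV₁ : IsVeluThreePair m₁ s₁ W W') (hV₂ : IsVeluThreePair m₂ s₂ W W') (hm : m₁ * s₁ = m₂ * s₂) (hs : s₁ ^ 2 = s₂ ^ 2)
    (P : W.toAffine.Point) : hV₁.pointFun P = hV₂.pointFun P := by
  rcases P with _ | ⟨x, y, h⟩
  · rfl
  · by_cases hx : x = 0
    · rw [hV₁.pointFun_some_of_eq_zero _ hx, hV₂.pointFun_some_of_eq_zero _ hx]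
    · rw [hV₁.pointFun_some _ hx, hV₂.pointFun_some _ hx]
      refine point_some_ext ?_ ?_
      · show (x ^ 3 + 4 * m₁ * s₁ * x + 4 * s₁ ^ 2) / x ^ 2 = (x ^ 3 + 4 * m₂ * s₂ * x + 4 * s₂ ^ 2) / x ^ 2
        rw [mul_assoc (4 : F') m₁ s₁, hm, hs, ← mul_assoc]
      · show y * (x ^ 3 - 4 * m₁ * s₁ * x - 8 * s₁ ^ 2) / x ^ 3 = y * (x ^ 3 - 4 * m₂ * s₂ * x - 8 * s₂ ^ 2) / x ^ 3
        rw [mul_assoc (4 : F') m₁ s₁, hm, hs, ← mul_assoc]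

/-- **The pair `(E_ℚ̄, E'_ℚ̄)`, `E = y² = x³ + k`, `E' = y² = x³ + k'`, `k' = −27k`, is a Vélu pair with parameters `(0, s)`** for every
`s ∈ ℚ̄` with `s² = k`. [cite: CremonaAlgorithms1997, §3.8] -/
theorem isVeluThreePair_baseChange_mordell {k k' : ℚ} (hk : k ≠ 0) (hk' : k' = -27 * k) {s : AlgebraicClosure ℚ}
    (hs : s ^ 2 = (k : AlgebraicClosure ℚ)) :
    IsVeluThreePair (0 : AlgebraicClosure ℚ) s ((mordellCurve k).baseChange (AlgebraicClosure ℚ))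
      ((mordellCurve k').baseChange (AlgebraicClosure ℚ)) where
  a₁_eq := by rw [mordellCurve_baseChange]; rfl
  a₂_eq := by rw [mordellCurve_baseChange, mordellCurve_a₂]; ring
  a₃_eq := by rw [mordellCurve_baseChange]; rfl
  a₄_eq := by rw [mordellCurve_baseChange, mordellCurve_a₄]; ring
  a₆_eq := by rw [mordellCurve_baseChange, mordellCurve_a₆, eq_ratCast, hs]
  a₁'_eq := by rw [mordellCurve_baseChange]; rfl
  a₂'_eq := by rw [mordellCurve_baseChange, mordellCurve_a₂]; ring
  a₃'_eq := by rw [mordellCurve_baseChange]; rfl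
  a₄'_eq := by rw [mordellCurve_baseChange, mordellCurve_a₄]; ring
  a₆'_eq := by
    rw [mordellCurve_baseChange, mordellCurve_a₆, eq_ratCast, hk']
    push_cast
    rw [← hs]; ring
  Δ_ne := by
    rw [mordellCurve_baseChange, mordellCurve_Δ, eq_ratCast]
    exact neg_ne_zero.mpr (mul_ne_zero (by norm_num) (pow_ne_zero 2 (by exact_mod_cast hk)))

variable {L : Type} [Field L] [NumberField L]

/-- **An embedding `j : L → ℚ̄` with `ι ∘ j = (L ↪ L̄)`** for the chosen `ι : ℚ̄ → L̄` (`ι` is bijective as `L/ℚ` is algebraic).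
[cite: SilvermanAEC2009, App. B §2] -/
theorem exists_ringHom_iotaE_comp :
    ∃ j : L →+* AlgebraicClosure ℚ, ∀ x : L, iotaE (K := ℚ) L (j x) = algebraMap L (AlgebraicClosure L) x := by
  haveI : Algebra.IsAlgebraic ℚ L := Algebra.IsAlgebraic.of_finite ℚ L
  refine ⟨((algEquivOfEmb L (iotaE (K := ℚ) L)).symm : AlgebraicClosure L ≃ₐ[ℚ] AlgebraicClosure ℚ).toRingEquiv.toRingHom.comp
    (algebraMap L (AlgebraicClosure L)), fun x => ?_⟩
  change iotaE (K := ℚ) L ((algEquivOfEmb L (iotaE (K := ℚ) L)).symm (algebraMap L (AlgebraicClosure L) x)) = _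
  rw [← algEquivOfEmb_apply L (iotaE (K := ℚ) L), AlgEquiv.apply_symm_apply]

variable (hL2 : Module.finrank ℚ L = 2) {g : L} {d : ℚ} (hg : g ^ 2 = (d : L)) (hgL : g ∉ Set.range (algebraMap ℚ L))
  (c : L ≃ₐ[ℚ] L) (hcg : c g = -g)

include hL2 hg hgL hcg in
/-- **Every `σ ∈ Γ_ℚ` acts on `j(L)` as the identity or as `c`** (`(σ(jg))² = d`, so `σ(jg) = ±jg`, and `L = ℚ ⊕ ℚg`).
[cite: Marcus2018, Ch. 2 (the conjugation `√m ↦ −√m`)] -/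
theorem galAut_apply_ringHom_dichotomy (j : L →+* AlgebraicClosure ℚ) (σ : Field.absoluteGaloisGroup ℚ) :
    (∀ x : L, galAut σ (j x) = j x) ∨ (∀ x : L, galAut σ (j x) = j (c x)) := by
  have hsq : galAut σ (j g) ^ 2 = j g ^ 2 := by
    rw [← map_pow, ← map_pow, hg, map_ratCast, map_ratCast]
  have hcoord : ∀ x : L, ∃ r s : ℚ, x = r + s * g := fun x => by
    obtain ⟨r, s, hx⟩ := Quadratic.exists_eq_add_mul hL2 hgL x
    exact ⟨r, s, by rw [hx, eq_ratCast, eq_ratCast]⟩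
  rcases sq_eq_sq_iff_eq_or_eq_neg.mp hsq with h | h
  · left
    intro x
    obtain ⟨r, s, rfl⟩ := hcoord x
    rw [map_add, map_mul, map_ratCast, map_ratCast, map_add, map_mul, map_ratCast, map_ratCast, h]
  · right
    intro x
    obtain ⟨r, s, rfl⟩ := hcoord x
    rw [map_add, map_mul, map_ratCast, map_ratCast, map_add, map_mul, map_ratCast, map_ratCast, h, map_add, map_mul,
      map_ratCast, map_ratCast, hcg, map_add, map_mul, map_ratCast, map_ratCast, map_neg]

/-- **`σ̃ = ι⁻¹ c̄ ι` acts on `j(L)` as `c`** when `ι ∘ j = (L ↪ L̄)` and `c̄` lifts `c`. [cite: CohenPazuki2009, Definition 1.3 (G₃)] -/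
theorem galAut_sigmaTilde_ringHom (cbar : AlgebraicClosure L ≃+* AlgebraicClosure L)
    (hcbar : ∀ x : L, cbar (algebraMap L (AlgebraicClosure L) x) = algebraMap L (AlgebraicClosure L) (c x))
    {j : L →+* AlgebraicClosure ℚ} (hj : ∀ x : L, iotaE (K := ℚ) L (j x) = algebraMap L (AlgebraicClosure L) x) (x : L) :
    galAut (sigmaTilde cbar) (j x) = j (c x) := by
  apply (iotaE (K := ℚ) L).injective
  have e := iotaE_sigmaTilde cbar (j x)
  rw [hj, hcbar, ← hj] at e
  exact e

end Inputs

/-! ## §2 Point descent -/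

section Descent

variable {L : Type} [Field L] [NumberField L] (hL2 : Module.finrank ℚ L = 2) {g : L} {d : ℚ} (hg : g ^ 2 = (d : L))
  (hgL : g ∉ Set.range (algebraMap ℚ L)) (c : L ≃ₐ[ℚ] L) (hcg : c g = -g)
  (cbar : AlgebraicClosure L ≃+* AlgebraicClosure L)
  (hcbar : ∀ x : L, cbar (algebraMap L (AlgebraicClosure L) x) = algebraMap L (AlgebraicClosure L) (c x))
  (hcbθ : cbar (theta L) = -theta L)
  {k k' : ℚ} (hk : k ≠ 0) (hk' : k' = -27 * k) (hk'sq : ∀ q : ℚ, q ^ 2 ≠ k')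
  (hX : IsKernelXThreePair (0 : ℚ) 0 k (mordellCurve k) (mordellCurve k'))
  {c₁ : L} (hc₁ : c₁ ≠ 0) (hkc₁ : (k : L) = -3 * c₁ ^ 2) (hcc₁ : c c₁ = -c₁)

include hcbar hcbθ hkc₁ hcc₁ in
/-- **`σ̃ • T = T`** for the kernel point `T = (0, gs)` of `φ` (`gs² = k`): `ι(gs) = ±c₁√−3` and `c̄(c₁√−3) = (−c₁)(−√−3)`.
[cite: CohenPazuki2009, Definition 1.3 (G₃)] -/
theorem sigmaTilde_smul_geomT : sigmaTilde cbar • hX.geomT = hX.geomT := by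
  have hgs : iotaE (K := ℚ) L hX.gs ^ 2 = sCoord c₁ ^ 2 := by
    rw [← map_pow, hX.gs_sq, eq_ratCast, map_ratCast, sCoord_sq, ← hkc₁, map_ratCast]
  have hzs : cbar (sCoord c₁) = sCoord c₁ := by
    rw [sCoord, map_mul, hcbar, hcbθ, hcc₁, map_neg]; ring
  have hσgs : galAut (sigmaTilde cbar) hX.gs = hX.gs := galAut_sigmaTilde_eq_self_of_sq_eq cbar hgs hzs
  change sigmaTilde cbar • (show geomPoints (mordellCurve k) from Affine.Point.some 0 hX.gs hX.geom.nonsingular_T) =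
    Affine.Point.some 0 hX.gs hX.geom.nonsingular_T
  rw [smul_geomPoints_some (sigmaTilde cbar) _ (nonsingular_galAut (sigmaTilde cbar) hX.geom.nonsingular_T)]
  exact point_some_ext (map_zero _) hσgs

include hL2 hg hgL hcg hcbar hcbθ hk hk' hk'sq hkc₁ hcc₁ in
/-- ★★ **Point descent through the twisted `3`-isogeny `φ : y² = x³ + k → y² = x³ − 27k`.** With the data of this section (Kummer field
`L = ℚ(g)`, conjugation `c`, lift `c̄` negating `√−3`, `k = −3c₁²`, `c c₁ = −c₁`) and the BOX IN SELMER FORM over `L` — every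
`u ∈ L^×` with `u·c(u)` a non-zero `c`-fixed cube whose class `[C_u]` lies in `Ш(E_L/L)` (`E_L = mordellCurve(−3c₁²)`) is a cube —
every `Γ_ℚ`-fixed point of `E'(ℚ̄)` is `φ(Q)` for a `Γ_ℚ`-fixed point `Q ∈ E(ℚ̄)`: `E'(ℚ) ⊆ φ(E(ℚ))`.
[cite: CohenPazuki2009, Proposition 2.2, Theorem 2.1] [cite: SilvermanAEC2009, Thm. X.4.2 (a), Prop. X.4.9] -/
theorem exists_fixed_preimage_of_fixed
    (hcube : ∀ {D : L} (hD : D = -3 * c₁ ^ 2) {u : L} (hu : u ≠ 0), (∃ r : L, c r = r ∧ r ≠ 0 ∧ u * c u = r ^ 3) →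
      torsorClass hc₁ hD hu ∈ (mordellCurve D).sha → ∃ w : L, u = w ^ 3)
    {P' : geomPoints (mordellCurve k')} (hP' : ∀ σ : Field.absoluteGaloisGroup ℚ, σ • P' = P') :
    ∃ Q : geomPoints (mordellCurve k), (∀ σ : Field.absoluteGaloisGroup ℚ, σ • Q = Q) ∧ hX.toIsogeny Q = P' := by
  obtain ⟨j, hj⟩ := exists_ringHom_iotaE_comp (L := L)
  have hc2 : ∀ x : L, c (c x) = x := fun x => algEquiv_apply_apply_of_finrank_eq_two hL2 c x
  have hσ₀j : ∀ x : L, galAut (sigmaTilde cbar) (j x) = j (c x) := fun x => galAut_sigmaTilde_ringHom c cbar hcbar hj x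
  have hk'0 : k' ≠ 0 := by rw [hk']; exact mul_ne_zero (by norm_num) hk
  rcases P' with _ | ⟨X₁, Y₁, hP₁⟩
  · exact ⟨0, fun σ => smul_zero σ, map_zero _⟩
  -- ### the coordinates of `P'` are rational
  have hfix : ∀ σ : Field.absoluteGaloisGroup ℚ, galAut σ X₁ = X₁ ∧ galAut σ Y₁ = Y₁ := by
    intro σ
    have e := hP' σ
    change σ • (show geomPoints (mordellCurve k') from Affine.Point.some X₁ Y₁ hP₁) = _ at e
    rw [smul_geomPoints_some σ hP₁ (nonsingular_galAut σ hP₁)] at e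
    exact Affine.Point.some.inj e
  obtain ⟨X₀, hX₀⟩ := exists_algebraMap_eq_of_forall_galAut (K := ℚ) (fun σ => (hfix σ).1)
  obtain ⟨Y₀, hY₀⟩ := exists_algebraMap_eq_of_forall_galAut (K := ℚ) (fun σ => (hfix σ).2)
  rw [eq_ratCast] at hX₀ hY₀
  subst hX₀ hY₀
  have hEq : Y₀ ^ 2 = X₀ ^ 3 + k' := by
    have e := hP₁.left
    rw [mordellCurve_baseChange, mordellCurve_equation_iff, eq_ratCast] at e
    exact_mod_cast e
  have hX₀0 : X₀ ≠ 0 := fun h0 => hk'sq Y₀ (by rw [hEq, h0]; ring)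
  -- ### the descent value `u = Y₀ + 9c₁ ∈ L` is a norm-cube with trivial torsor class, hence a cube
  have h81 : (81 : L) * c₁ ^ 2 = (k' : L) := by rw [hk']; push_cast; linear_combination 27 * hkc₁
  have hEqL : ((Y₀ : L)) ^ 2 = (X₀ : L) ^ 3 + 81 * c₁ ^ 2 := by rw [h81]; exact_mod_cast hEq
  have hPL : (mordellCurve (81 * c₁ ^ 2)).toAffine.Nonsingular (X₀ : L) (Y₀ : L) :=
    nonsingular_mordellCurve_of_equation (by rw [h81]; exact_mod_cast hk'0) ((mordellCurve_equation_iff _ _ _).mpr hEqL)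
  have hu0 := phiDescent_ne_zero hc₁ (Affine.Point.some _ _ hPL)
  have huval : phiDescent c₁ (Affine.Point.some _ _ hPL) = (Y₀ : L) + 9 * c₁ := by
    rw [phiDescent_some, if_neg]
    intro hY
    apply hX₀0
    have h3 : ((X₀ : L)) ^ 3 = 0 := by rw [hY] at hEqL; linear_combination -hEqL
    exact_mod_cast (pow_eq_zero_iff three_ne_zero).mp h3
  have hsha : torsorClass hc₁ rfl hu0 ∈ (mordellCurve (-3 * c₁ ^ 2)).sha := by
    rw [torsorClass_phiDescent hc₁ rfl]; exact zero_mem _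
  have hnorm : ∃ r : L, c r = r ∧ r ≠ 0 ∧
      phiDescent c₁ (Affine.Point.some _ _ hPL) * c (phiDescent c₁ (Affine.Point.some _ _ hPL)) = r ^ 3 := by
    refine ⟨(X₀ : L), map_ratCast c X₀, by exact_mod_cast hX₀0, ?_⟩
    rw [huval, map_add, map_mul, map_ratCast, map_ofNat, hcc₁]
    linear_combination hEqL
  obtain ⟨w, hw⟩ := hcube rfl hu0 hnorm hsha
  rw [huval] at hw
  have hw0 : w ≠ 0 := by
    rintro rfl
    rw [zero_pow three_ne_zero] at hw
    exact hu0 (huval.trans hw)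
  -- ### the explicit preimage over `ℚ̄`
  have hγ : j w ^ 3 = (Y₀ : AlgebraicClosure ℚ) + 9 * j c₁ := by
    rw [← map_pow, ← hw, map_add, map_mul, map_ratCast, map_ofNat]
  have hγ0 : j w ≠ 0 := (map_ne_zero j).mpr hw0
  have hjc0 : j c₁ ≠ 0 := (map_ne_zero j).mpr hc₁
  have hE' : (Y₀ : AlgebraicClosure ℚ) ^ 2 = (X₀ : AlgebraicClosure ℚ) ^ 3 + 81 * j c₁ ^ 2 := by
    have e := congrArg j hEqL
    rw [map_pow, map_ratCast, map_add, map_pow, map_ratCast, map_mul, map_pow, map_ofNat] at e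
    exact e
  have hkQ : (k : AlgebraicClosure ℚ) = -3 * j c₁ ^ 2 := by
    have e := congrArg j hkc₁
    rw [map_ratCast, map_mul, map_neg, map_ofNat, map_pow] at e
    exact e
  have hs : (j c₁ * theta ℚ) ^ 2 = (k : AlgebraicClosure ℚ) := by
    rw [mul_pow, theta_sq ℚ, hkQ]; ring
  have hV₁ := isVeluThreePair_baseChange_mordell hk hk' hs
  have hpre := preim_equation hjc0 hγ hγ0 hE'
  have hQns : ((mordellCurve k).baseChange (AlgebraicClosure ℚ)).toAffine.Nonsingular
      (preimX (j c₁) (X₀ : AlgebraicClosure ℚ) (j w)) (preimY (j c₁) (X₀ : AlgebraicClosure ℚ) (j w)) :=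
    (Affine.equation_iff_nonsingular_of_Δ_ne_zero (W := ((mordellCurve k).baseChange (AlgebraicClosure ℚ)).toAffine) hV₁.Δ_ne).mp
      ((hV₁.equation_iff _ _).mpr (by rw [hpre]; linear_combination (-(j c₁) ^ 2) * theta_sq ℚ))
  obtain ⟨Q, hQ⟩ : ∃ Q : geomPoints (mordellCurve k), Q = Affine.Point.some _ _ hQns := ⟨_, rfl⟩
  have hms : hX.gm * hX.gs = 0 * (j c₁ * theta ℚ) := by
    have e := hX.four_mul_gm_mul_gs
    rw [map_zero, mul_zero] at e
    rw [zero_mul]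
    have h4 : (4 : AlgebraicClosure ℚ) ≠ 0 := by norm_num
    rcases mul_eq_zero.mp e with h | h
    · rcases mul_eq_zero.mp h with h' | h'
      · exact absurd h' h4
      · rw [h', zero_mul]
    · rw [h, mul_zero]
  have hss : hX.gs ^ 2 = (j c₁ * theta ℚ) ^ 2 := by rw [hX.gs_sq, eq_ratCast, hs]
  have hφpre : hV₁.pointFun (Affine.Point.some _ _ hQns) =
      Affine.Point.some (X₀ : AlgebraicClosure ℚ) (Y₀ : AlgebraicClosure ℚ) hP₁ :=
    pointFun_preim hV₁ (theta_sq ℚ) hjc0 hγ hγ0 hE' hQns hP₁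
  have hφQ : hX.toIsogeny Q = Affine.Point.some (X₀ : AlgebraicClosure ℚ) (Y₀ : AlgebraicClosure ℚ) hP₁ := by
    rw [hQ, IsKernelXThreePair.toIsogeny_apply]
    exact (pointFun_eq_of_mul_eq_of_sq_eq hX.geom hV₁ hms hss _).trans hφpre
  -- ### Galois: `σ` acts on the coordinates of `Q` (which lie in `j(L)`) as `1` or as `σ̃`
  have hxj : preimX (j c₁) (X₀ : AlgebraicClosure ℚ) (j w) = j (preimX c₁ (X₀ : L) w) := by
    simp only [preimX, map_div₀, map_mul, map_sub, map_ofNat, map_ratCast]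
  have hyj : preimY (j c₁) (X₀ : AlgebraicClosure ℚ) (j w) = j (preimY c₁ (X₀ : L) w) := by
    simp only [preimY, preimX, map_div₀, map_mul, map_sub, map_ofNat, map_ratCast]
  have hQid : ∀ σ : Field.absoluteGaloisGroup ℚ, (∀ x : L, galAut σ (j x) = j x) → σ • Q = Q := by
    intro σ hσ
    rw [hQ]
    change σ • (show geomPoints (mordellCurve k) from Affine.Point.some _ _ hQns) = _
    rw [smul_geomPoints_some σ hQns (nonsingular_galAut σ hQns)]
    exact point_some_ext (by rw [hxj, hσ]) (by rw [hyj, hσ])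
  have hQc : ∀ σ : Field.absoluteGaloisGroup ℚ, (∀ x : L, galAut σ (j x) = j (c x)) → σ • Q = sigmaTilde cbar • Q := by
    intro σ hσ
    rw [hQ]
    change σ • (show geomPoints (mordellCurve k) from Affine.Point.some _ _ hQns) =
      sigmaTilde cbar • (show geomPoints (mordellCurve k) from Affine.Point.some _ _ hQns)
    rw [smul_geomPoints_some σ hQns (nonsingular_galAut σ hQns),
      smul_geomPoints_some (sigmaTilde cbar) hQns (nonsingular_galAut (sigmaTilde cbar) hQns)]
    exact point_some_ext (by rw [hxj, hσ, hσ₀j]) (by rw [hyj, hσ, hσ₀j])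
  -- ### `σ̃ Q = Q`: `σ̃Q − Q ∈ ker φ = {O, ±T}`, `σ̃T = T`, `σ̃² = 1` on `j(L)`, `2T ≠ O`
  have hσT : sigmaTilde cbar • hX.geomT = hX.geomT := sigmaTilde_smul_geomT c cbar hcbar hcbθ hX hkc₁ hcc₁
  have hTT : hX.geomT + hX.geomT = -hX.geomT := hX.geom.T_add_T
  have hT0 : hX.geomT ≠ 0 := hX.geomT_ne_zero
  have h2 : sigmaTilde cbar • (sigmaTilde cbar • Q) = Q := by
    rw [← mul_smul]
    apply hQid
    intro x
    rw [galAut_mul_apply, hσ₀j, hσ₀j, hc2]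
  have hker : sigmaTilde cbar • Q - Q = 0 ∨ sigmaTilde cbar • Q - Q = hX.geomT ∨ sigmaTilde cbar • Q - Q = -hX.geomT := by
    have e : hX.toIsogeny (sigmaTilde cbar • Q - Q) = 0 := by
      rw [map_sub, hX.toIsogeny.map_smul, hφQ, hP', sub_self]
    rw [IsKernelXThreePair.toIsogeny_apply] at e
    exact (hX.geom.pointFun_eq_zero_iff _).mp e
  have hσQ : sigmaTilde cbar • Q = Q := by
    rcases hker with h | h | h
    · exact sub_eq_zero.mp h
    · exfalso
      have e : sigmaTilde cbar • Q = Q + hX.geomT := by rw [← h]; abel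
      rw [e, smul_add, hσT, e, add_assoc, add_eq_left, hTT, neg_eq_zero] at h2
      exact hT0 h2
    · exfalso
      have e : sigmaTilde cbar • Q = Q + -hX.geomT := by rw [← h]; abel
      rw [e, smul_add, smul_neg, hσT, e, add_assoc, add_eq_left, ← neg_add, hTT, neg_neg] at h2
      exact hT0 h2
  refine ⟨Q, fun σ => ?_, hφQ⟩
  rcases galAut_apply_ringHom_dichotomy hL2 hg hgL c hcg j σ with hσ | hσ
  · exact hQid σ hσ
  · rw [hQc σ hσ, hσQ]

end Descent

end Summit.BirchSwinnertonDyer.BirchSwinnertonDyer.Theorems.SylvesterTwistDescent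

end
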